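/-
COR-CM (cells pub-hodgecm / pub-hodgecm2, stage 2 of the Hodge ladder) — TRANSPOSITION SURGE, item (vi) sub-binder S2 / (vi-2)
`supply`, TEAM hCMisogE (coordinator ruling «HODGE: FINISH AS FAST AS POSSIBLE» 2026-08-21T18:44:30Z (1); owner of record of the
binder `hCMisogE` = pin-2; pin-2's BRIEF `HOME/pinning/hcmisog/BRIEF.md` §1 (G); hcmisog-lead SHAPE FREEZE 19:31:46Z / INTERFACE OF RECORD 19:41:15Z; path
`Transposition/Item6SupplyPinnedDef45.lean` under the pub-hodgecm2 lead's blanket pre-ACK `Transposition/Item6*` (hcmisog-lead 19:37:42Z)).  Seat prover-pub-hodgecm2-hcmisog-glue-0 = (G) GLUE, the ONE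
writer of this path.  Theorems only: no definition, no instance, no named fact, nothing asserted, no proof holes.  Binder texts COPIED token for token from pin-3's staged
display `Item6SupplyPinnedAssembly.lean` v4 (7ee352789537, unfiled; not imported).  Imported BY NAME, never edited or restated: pin-2's `Item6PinMatch.lean`,
pin-1's `Item6PinReach.lean`, own-htheta's `Item6SupplyPinned.lean`, hcmisog-isog-2's `Item6PinMatchDef45.lean` (over b01's
`Item6PinMatchDet.lean`, item6-p1's `Liu2021/Def45AsPrinted.lean`, b18's `HodgeTheory/AbelianVarietyCotangentHodge.lean`, binder-1's
`CMTypeOfHodgeDeterminant.lean`, tr-prover-1's `ReflexNormInducedType.lean`).  Decl names carry the `_pinnedE_def45` suffix.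
FRAMING: HC_CM is NOT proved.
-/
import Summits.HodgeConjecture.CorCM.B01.Transposition.Item6PinMatchDef45
import Summits.HodgeConjecture.CorCM.B01.Transposition.Item6SupplyPinned
import Summits.HodgeConjecture.CorCM.B01.Transposition.Item6PinMatch
import Summits.HodgeConjecture.CorCM.B01.Transposition.Item6PinReach
import Literature.AlgebraicGeometry.Motives.AbelianVarietyProjective
import HarnessLib

/-!
# Item (vi) S2 from [Liu 2021, Thm. 4.18] AS PRINTED at the E-rational pin — the CM side DISCHARGED to [Liu 2021, Def. 4.5 (2)]

pin-3's staged assembly `Model.hc_cm_of_thm418AsPrinted_pinnedE_isog` (`Transposition/Item6SupplyPinnedAssembly.lean` v4, unfiled; = pin-2's junction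
`Model.faceSupply_of_thm418AsPrinted_pinned_isog`, `Item6PinMatch.lean` §4, composed with pin-1's `Model.pinReach_of_componentPinE` and the
`L²` dictionary) derives `HC_CM` on the universe of record from [Liu2021] Thm. 4.18 EXACTLY AS PRINTED (`hLiu`) and its printed-elsewhere
carriers, with TWO residual PINNING-RECORD binders at the E-rational pin `A_μ ⊗_{E,ι₁} ℂ := (Aμ₀ F ι₁ V Φ D_μ).baseChange ℂ`:
`hComp` (pin-1, the REACH half) and

  `hCMisogE` — «`A_μ ⊗_{E,ι₁} ℂ` is ISOGENOUS to a complex abelian variety with multiplication by `𝓞_{M_μ}` realising on `H¹_B` the type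
  `Ψ̃_μ = inducedCMType e_μ (reflexCMType ι₁ Φ_μ id)`» (pin-2's `hCMisog`, `Item6PinMatch.lean`:352).

THIS FILE is the same junction and END display with `hCMisogE` NO LONGER A BINDER.  In its place stand (TEAM hCMisogE, sub-objects
(L1a) b11 · (L1b) b17 · (L2) b18 · (N) tr-prover-1 · (I1) item6-p1 · (I2-H)/(I2-H′) binder-1 · (I2) b01 + hcmisog-isog-2 · (G) this file):
* the carrier `i` and the binders `hdim`, `hdet45` = [Liu2021] Def. 4.5 (2) ON THE CONSUMER'S `A_μ` (`FJcycle.tex` l. 1944–1951):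
  «`A_μ` is an abelian variety over `E`; `i_μ : M_μ → End_E(A_μ)_ℚ` is a CM structure such that • for every `x ∈ M_μ`, the determinant of
  the action of `i_μ(x)` on the `E`-vector space `Lie_E(A_μ)` equals `η_μ(x)`», with `η_μ := η'_μ ∘ Nm_{M_μ/M'_μ}` (Def. 4.5 (1) l. 1939–1942)
  DEFINED as the reflex type norm composed with the field norm (item6-p1's `Def45.eta`) and the first bullet typed on the cotangent space
  `𝔪_e/𝔪_e² = Lie_E(A_μ)^∨` (b11's `AbelianVariety.cotangentMap`; `Def45.CMDatum.det45` token for token) — at Liu's objects these are the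
  projections of the as-printed typing `Def45.CMDatum`;
* `hdetBC` — the determinant form of flat base change of cotangent spaces, `det T_e^*(u_L) = det T_e^*(u)` for every `L/K`, `A/K`,
  `u ∈ End_K(A)` ([GortzWedhorn2020 Rem. 6.12]; object-independent; proved in b17's `Motives/AbelianVarietyCotangentBaseChangeIso.lean` as
  `AbelianVariety.det_cotangentMap_baseChange`, discharged by that one name when it lands);
* `hW : cotangent_hodge10_comparison` — the ONE cited theorem of the CM side: «`H^{1,0}` of a complex abelian variety is its cotangent
  space at the origin, `End`-equivariantly» ([LangeBirkenhake1992 §1.1.5 (1.6), Lemma 1.1.22, Thm. 1.1.21, Cor. 1.1.7; Shimura1998 §2.6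
  Prop. 3, §2.8, §3.2; SerreGAGA1956 n°5–7]; b18's named fact, D-0026 debt of (L2)).
The identification «the CM type over `M_μ` of `A_μ ⊗_{E,ι₁} ℂ` is `Ψ̃_μ`» is then the KERNEL theorem `Model.hCMisogE_of_det45`
(hcmisog-isog-2): first bullet ⟹ `det(x | T_e^*(A_μ)) = η_μ(x)` ⟹ (base change `hdetBC`, Hodge comparison `hW`) `det(x | H^{1,0}(A_μ ⊗ ℂ))
= ι₁(η_μ(x)) = ∏_{θ ∈ Ψ̃_μ} θ(x)` (tr-prover-1's type-norm identity) ⟹ type `Ψ̃_μ` up to isogeny (binder-1, [Shimura1998 §5.2, §7.1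
Prop. 7], principalisation of the `𝓞_{M_μ}`-lattice).

READING / STRENGTH (for the red team and the T5 seat): binder set = pin-3's display's MINUS `hCMisogE` PLUS {`hdim`, `hdet45`, `hdetBC`,
`hW`} over the extra carrier `i`; `{i, hdim, hdet45, hdetBC, hW} ⟹ hCMisogE` at every guarded face, no converse claimed; the universe
fact `Thm418Data.Obj : Type` vs `Def45.CMDatum … : Type 1` is why Liu's datum enters through its REAL fields on the consumer's pin and not
as the carrier `Obj` itself (hcmisog-lead D5/FREEZE, NAMES-G).  NOT claimed: that Liu's `X_K` / `A_K` / `A_μ` are constructed; that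
`hComp` / `hD` / `hdetBC` are inhabited; that HC_CM is proved.

References: Y. Liu, *Fourier–Jacobi cycles and arithmetic relative trace formula*, Camb. J. Math. 9 (2021) = arXiv:2102.11518
(`FJcycle.tex` md5 6db49a74122d): Def. 4.3 (2) l. 1914–1921, §4.1 l. 1924–1928, Def. 4.5 l. 1936–1964, Prop. 4.6 (1) l. 1969, §4.2
l. 2053–2076, Def. 4.11 l. 2083–2097, Thm. 4.18 l. 2232–2245; G. Shimura, *Abelian Varieties with Complex Multiplication and Modular
Functions* (1998) §5.2, §6.2 Thm. 3, §7.1 Prop. 7, §8.3 Prop. 28; H. Lange, Ch. Birkenhake, *Complex Abelian Varieties* (1992) §1.1;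
U. Görtz, T. Wedhorn, *Algebraic Geometry I* (2020) Rem. 6.12; D. Mumford, *Abelian Varieties* §19.
-/

noncomputable section

open scoped TensorProduct InnerProductSpace

namespace Summit.HodgeConjecture.CorCM.Model
open CategoryTheory CategoryTheory.Limits AlgebraicGeometry NumberField
open Literature.AlgebraicGeometry.Motives
open Literature.AlgebraicGeometry.ShimuraVarieties
open Literature.AlgebraicGeometry.Motives.HodgeStructure (conj)
open Literature.AlgebraicGeometry.HodgeTheory
open Literature.AlgebraicGeometry.ComplexMultiplication (IsCMTypeRealisation)
open Literature.NumberTheory.ComplexMultiplication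
open Literature.NumberTheory.Automorphic
open Literature.NumberTheory.Automorphic.IdeleClassGroup
open Literature.NumberTheory.Automorphic.PicardCM
open Literature.NumberTheory.Automorphic.Liu2021

/-! ## §1  The junction and the END display at the E-rational pin, CM side discharged to Def. 4.5 (2) data -/

section Display

/-- **B01-S from [Liu 2021, Thm. 4.18] AS PRINTED at the E-RATIONAL pin, the CM side DISCHARGED to Liu's Def. 4.5 (2) data**
(`U = picardCMUniverse hHD hI h₁ h₃`).  This is the assembly's junction `Model.faceSupply_of_thm418AsPrinted_pinnedE_isog` (pin-3;
= pin-2's `Model.faceSupply_of_thm418AsPrinted_pinned_isog`, `Item6PinMatch.lean` §4, at the pin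
`A_μ ⊗_{E,ι₁} ℂ := (Aμ₀ F ι₁ V Φ D_μ).baseChange ℂ` along `ι₁`) with ITS CM-SIDE BINDER `hCMisogE` («`A_μ ⊗_{E,ι₁} ℂ` is isogenous to an
`𝓞_{M_μ}`-realisation of `Ψ̃_μ`») NO LONGER A HYPOTHESIS: it is supplied by hcmisog-isog-2's identification `Model.hCMisogE_of_det45`
(`Transposition/Item6PinMatchDef45.lean`) from the following, which replace it in the binder list (all other carriers and binders —
`D`, `Aμ₀`, `AK`, `homE`, `hE`, `hLiu`, `hObj`, `hChi`, `hirr`, `hsm`, `hμ`, `hComp` — are pin-3's, TOKEN FOR TOKEN):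
* carrier `i F ι₁ V Φ D_μ : M_μ →+* End⁰(A_μ)` — [Liu2021] Def. 4.5 (2) «`i_μ : M_μ → End_E(A_μ)_ℚ` is a CM structure» (`FJcycle.tex`
  l. 1947–1948), RATIONAL as printed (`M_μ = muAlgValueField F μ`, §4.1 l. 1928);
* `hdim` — «CM structure»: `[M_μ : ℚ] = 2 dim A_μ` (l. 1947–1948; `Def45.CMDatum.finrank_eq`);
* `hdet45` — the FIRST BULLET «for every `x ∈ M_μ`, the determinant of the action of `i_μ(x)` on the `E`-vector space `Lie_E(A_μ)`
  equals `η_μ(x)`» (l. 1949–1950), typed on the cotangent space `𝔪_e/𝔪_e² = Lie_E(A_μ)^∨` in the cleared form of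
  `Def45.CMDatum.det45` with `η_μ := η'_μ ∘ Nm_{M_μ/M'_μ}` DEFINED (`Def45.eta`, Def. 4.5 (1) l. 1939–1942);
* `hdetBC` — the determinant form of flat base change of the cotangent space: for every field extension `L/K`, abelian variety
  `A/K` and `u ∈ End_K(A)`, `det T_e^*(u_L) = det T_e^*(u)` in `L` ([GortzWedhorn2020 Rem. 6.12 (2)–(3)]; [Hartshorne II Prop. 8.10];
  object-independent; KERNEL in b17's `Motives/AbelianVarietyCotangentBaseChangeIso.lean`, `AbelianVariety.det_cotangentMap_baseChange` —
  a pending-kernel binder, discharged by that one name when the file lands);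
* `hW` — the cited Hodge comparison `cotangent_hodge10_comparison` («`H^{1,0}(B) ≅ T_e^*(B)` `End`-equivariantly for complex abelian
  varieties», b18's `HodgeTheory/AbelianVarietyCotangentHodge.lean`; [LangeBirkenhake1992 §1.1.5 (1.6), Lemma 1.1.22, Thm. 1.1.21,
  Cor. 1.1.7; Shimura1998 §2.6–2.8; SerreGAGA1956]).
At Liu's objects (`(D …).Obj` read as the CM data `D_μ = (A_μ, i_μ, λ_μ, r_μ) ∈ 𝒜(μ)` of the as-printed typing `Def45.CMDatum`,
item6-p1) `i`, `hdim`, `hdet45` are the projections `CMDatum.i`, `CMDatum.finrank_eq`, `CMDatum.det45`.  KERNEL, BY NAME: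
`Model.faceSupply_of_thm418AsPrinted_pinned_isog` (pin-2) ∘ `Model.hCMisogE_of_det45` (hcmisog-isog-2, over b01's
`Model.exists_isogeny_isCMTypeRealisation_baseChange_of_detInvariant`, binder-1's `exists_isogeny_isCMTypeRealisation_of_det_complexAction`,
item6-p1's `Def45`, tr-prover-1's (N)) ∘ `Model.pinReach_of_componentPinE` (pin-1).  No degree- or face-specific input beyond the guards.
HC_CM is NOT proved; `hComp` (pin-1's REACH half), `hdetBC`, `hW` and the Liu-side binders are NOT inhabited here; NOT claimed: that
Liu's `X_K` / `A_K` / `A_μ` are constructed.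
[cite: Liu2021, Thm. 4.18 (FJcycle.tex l. 2232–2245), Def. 4.5 (1)–(2) (l. 1936–1951), Def. 4.3 (2) (l. 1919) and §4.1 l. 1928]
[cite: Shimura1998, §5.2, §6.2 Theorem 3, §7.1 Prop. 7 and §8.3 Prop. 28] -/
theorem faceSupply_of_thm418AsPrinted_pinnedE_def45
    (hHD : exists_isReal_hodgeModel) (hI : hodgePQ_independent_of_hodgeModel)
    (h₁ : BallQuotientUniformised) (h₃ : CMAbelianVarietyRealised)
    (D : ∀ (F : CMField) (ι₁ : F →+* ℂ) (_ : HermSpace3 F ι₁) (_ : CMType F), Thm418Data (maximalRealSubfield F) F)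
    (Aμ₀ : ∀ (F : CMField) (ι₁ : F →+* ℂ) (V : HermSpace3 F ι₁) (Φ : CMType F), (D F ι₁ V Φ).Obj → AbelianVariety F)
    (AK : ∀ (F : CMField) (ι₁ : F →+* ℂ) (V : HermSpace3 F ι₁) (Φ : CMType F), Subgroup (D F ι₁ V Φ).G → AbelianVariety F)
    (homE : ∀ (F : CMField) (ι₁ : F →+* ℂ) (V : HermSpace3 F ι₁) (Φ : CMType F) (K : Subgroup (D F ι₁ V Φ).G)
      (Dμ : (D F ι₁ V Φ).Obj), (D F ι₁ V Φ).HomK K Dμ →+ ℚ ⊗[ℤ] (AK F ι₁ V Φ K ⟶ Aμ₀ F ι₁ V Φ Dμ))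
    (hE : ∀ (F : CMField) (ι₁ : F →+* ℂ) (V : HermSpace3 F ι₁) (Φ : CMType F) (K : Subgroup (D F ι₁ V Φ).G)
      (Dμ : (D F ι₁ V Φ).Obj), Function.Injective (homE F ι₁ V Φ K Dμ))
    (hLiu : ∀ (F : CMField), IsGalois ℚ F → 6 ≤ Module.finrank ℚ F → ∀ (Φ : CMType F) (ι₁ : F →+* ℂ), ι₁ ∈ Φ.1 →
      ∀ V : HermSpace3 F ι₁, Thm418AsPrinted (D F ι₁ V Φ))
    (hObj : ∀ (F : CMField), IsGalois ℚ F → 6 ≤ Module.finrank ℚ F → ∀ (Φ : CMType F) (ι₁ : F →+* ℂ), ι₁ ∈ Φ.1 →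
      ∀ V : HermSpace3 F ι₁, Nonempty (D F ι₁ V Φ).Obj)
    (hChi : ∀ (F : CMField), IsGalois ℚ F → 6 ≤ Module.finrank ℚ F → ∀ (Φ : CMType F) (ι₁ : F →+* ℂ), ι₁ ∈ Φ.1 →
      ∀ V : HermSpace3 F ι₁, Nonempty (D F ι₁ V Φ).Chi)
    (hirr : ∀ (F : CMField), IsGalois ℚ F → 6 ≤ Module.finrank ℚ F → ∀ (Φ : CMType F) (ι₁ : F →+* ℂ), ι₁ ∈ Φ.1 →
      ∀ (V : HermSpace3 F ι₁) (i : (D F ι₁ V Φ).AdmIndex), ((D F ι₁ V Φ).rhoAt i).IsIrreducible)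
    (hsm : ∀ (F : CMField), IsGalois ℚ F → 6 ≤ Module.finrank ℚ F → ∀ (Φ : CMType F) (ι₁ : F →+* ℂ), ι₁ ∈ Φ.1 →
      ∀ (V : HermSpace3 F ι₁) (i : (D F ι₁ V Φ).AdmIndex) (v : (D F ι₁ V Φ).omegaAt i),
        ∃ S : Subgroup (D F ι₁ V Φ).G, IsOpen (S : Set (D F ι₁ V Φ).G) ∧ ∀ k ∈ S, (D F ι₁ V Φ).rhoAt i k v = v)
    (hμ : ∀ (F : CMField), IsGalois ℚ F → 6 ≤ Module.finrank ℚ F → ∀ (Φ : CMType F) (ι₁ : F →+* ℂ), ι₁ ∈ Φ.1 →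
      ∀ (V : HermSpace3 F ι₁) (g : F ≃ₐ[ℚ] F),
        ι₁.comp (g : F →+* F) ∈ (D F ι₁ V Φ).cmType.1 ↔ ι₁.comp (g.symm : F →+* F) ∈ Φ.1)
    (i : ∀ (F : CMField) (ι₁ : F →+* ℂ) (V : HermSpace3 F ι₁) (Φ : CMType F) (Dμ : (D F ι₁ V Φ).Obj),
      muAlgValueField F (D F ι₁ V Φ).μ →+* (Aμ₀ F ι₁ V Φ Dμ).endAlgebra)
    (hdim : ∀ (F : CMField) [IsGalois ℚ F], 6 ≤ Module.finrank ℚ F → ∀ (Φ : CMType F) (ι₁ : F →+* ℂ), ι₁ ∈ Φ.1 →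
      ∀ (V : HermSpace3 F ι₁) (Dμ : (D F ι₁ V Φ).Obj),
        Module.finrank ℚ (muAlgValueField F (D F ι₁ V Φ).μ) = 2 * (Aμ₀ F ι₁ V Φ Dμ).dim)
    (hdet45 : ∀ (F : CMField) [IsGalois ℚ F], 6 ≤ Module.finrank ℚ F → ∀ (Φ : CMType F) (ι₁ : F →+* ℂ), ι₁ ∈ Φ.1 →
      ∀ (V : HermSpace3 F ι₁) (Dμ : (D F ι₁ V Φ).Obj) (x : muAlgValueField F (D F ι₁ V Φ).μ) (M : ℕ)
        (f : End (Aμ₀ F ι₁ V Φ Dμ)), M ≠ 0 →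
        i F ι₁ V Φ Dμ x =
          algebraMap ℚ (Aμ₀ F ι₁ V Φ Dμ).endAlgebra (M : ℚ)⁻¹ * AbelianVariety.endAlgebra.of (Aμ₀ F ι₁ V Φ Dμ) f →
        LinearMap.det (AbelianVariety.cotangentMap (Aμ₀ F ι₁ V Φ Dμ) f) =
          (M : F) ^ (Aμ₀ F ι₁ V Φ Dμ).dim * Def45.eta (AlgHom.id ℚ F) ι₁ (D F ι₁ V Φ).isConjugateSymplectic x)
    (hdetBC : ∀ (K : Type) [Field K] (L : Type) [Field L] [Algebra K L] (A : AbelianVariety K) (u : A ⟶ A),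
      LinearMap.det (AbelianVariety.cotangentMap (A.baseChange L) (AbelianVariety.Hom.baseChange L u)) =
        algebraMap K L (LinearMap.det (AbelianVariety.cotangentMap A u)))
    (hW : cotangent_hodge10_comparison)
    (hComp : ∀ (F : CMField), IsGalois ℚ F → 6 ≤ Module.finrank ℚ F → ∀ (Φ : CMType F) (ι₁ : F →+* ℂ), ι₁ ∈ Φ.1 →
      ∀ V : HermSpace3 F ι₁, ∃ Ksm : Subgroup (D F ι₁ V Φ).G, IsOpenCompact Ksm ∧
        ∀ K : Subgroup (D F ι₁ V Φ).G, IsOpenCompact K → K ≤ Ksm →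
          ∃ (C : Type) (_ : Fintype C) (X : C → SchemeOver ℂ) (B : ∀ c, UnitaryBallUniformisationDatum 2 (X c))
            (Γ : C → Level V) (𝒥 : ∀ c, Jacobian (X c))
            (π : ∀ c, (letI := ι₁.toAlgebra; (AK F ι₁ V Φ K).baseChange ℂ) ⟶ (𝒥 c).J),
            (∀ c, (B c).Hℂ = V.Hm.map ι₁) ∧
            (∀ c, (B c).Γ.map (Matrix.GeneralLinearGroup.map (B c).τ₁) =
              (Γ c).Γ.map (Matrix.GeneralLinearGroup.map ι₁)) ∧
            Nonempty (IsLimit (Fan.mk (letI := ι₁.toAlgebra; (AK F ι₁ V Φ K).baseChange ℂ) π))) :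
    (picardCMUniverse hHD hI h₁ h₃).FaceSupply :=
  faceSupply_of_thm418AsPrinted_pinned_isog hHD hI h₁ h₃ D
    (fun F ι₁ V Φ Dμ => letI := ι₁.toAlgebra; (Aμ₀ F ι₁ V Φ Dμ).baseChange ℂ)
    hLiu hObj hChi hirr hsm hμ (fun F _ h6 Φ ι₁ hι V Dμ => hCMisogE_of_det45 hW hdetBC D Aμ₀ i hdim hdet45 F h6 Φ ι₁ hι V Dμ)
    (pinReach_of_componentPinE h₁ h₃ D AK Aμ₀ homE hE hComp)

/-- **END DISPLAY at the E-rational pin with the CM side DISCHARGED** (`hU : U = U_rec`, instantiate with `rfl`): `HC_CM` from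
[Liu 2021, Thm. 4.18] AS PRINTED (`hLiu`), its printed-elsewhere carriers (`hObj` Prop. 4.6 (1) l. 1969; `hChi` Def. 4.11 l. 2090;
`hirr`/`hsm` Def. 4.11 l. 2096), the CHOICE `hμ` (`Φ_μ = Φ^{*ι₁}`), Liu's `A_μ` OVER `E` (`Aμ₀`, Def. 4.5 (2) l. 1944) WITH ITS
RATIONAL CM STRUCTURE `i` and the two printed clauses `hdim` / `hdet45` of Def. 4.5 (2) (l. 1947–1950, first bullet on `Lie_E(A_μ)`,
`η_μ` DEFINED), the determinant form of cotangent base change `hdetBC` ([GortzWedhorn2020 Rem. 6.12], pending kernel) and ONE cited theorem `hW`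
(`cotangent_hodge10_comparison`, [LangeBirkenhake1992 §1.1]) IN PLACE OF the identification binder `hCMisogE` of
`Model.hc_cm_of_thm418AsPrinted_pinnedE_isog`; pin-1's `AK`/`homE`/`hE`/`hComp` (§4.2 l. 2060–2076, item (1) l. 2239, App. C Prop. C.5)
and the `L²` dictionary with isolation `hD` (items (iii)+(v) at `Θ := Uiso`, verbatim from `Model.hc_cm_of_supply_of_dictionary_of_eq`,
`Item6HoldsRec.lean`) UNCHANGED, every binder GUARDED to Galois CM `F`, `6 ≤ [F:ℚ]`, `Φ ∋ ι₁`.  Composition BY NAME: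
`hc_cm_of_supply_of_dictionary_of_eq _ rfl` ∘ `exists_supplyWitness_of_faceSupply` ∘ §1.  [GR91 Prop. 3.1.1] does not enter.  HC_CM is
NOT proved: `hComp`, `hD`, `hdetBC`, the cite binders `hLiu`/`hW` and the Liu-side carriers are hypotheses, not inhabited here.
[cite: Liu2021, Thm. 4.18 (FJcycle.tex l. 2232–2245) and Def. 4.5 (1)–(2) (l. 1936–1951)] -/
theorem hc_cm_of_thm418AsPrinted_pinnedE_def45 (U : Universe)
    (hU : U = picardCMUniverse exists_isReal_hodgeModel_holds hodgePQ_independent_of_hodgeModel_holds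
      BallQuotient.ballQuotientUniformised_holds cmAbelianVarietyRealised_holds)
    (D : ∀ (F : CMField) (ι₁ : F →+* ℂ) (_ : HermSpace3 F ι₁) (_ : CMType F), Thm418Data (maximalRealSubfield F) F)
    (Aμ₀ : ∀ (F : CMField) (ι₁ : F →+* ℂ) (V : HermSpace3 F ι₁) (Φ : CMType F), (D F ι₁ V Φ).Obj → AbelianVariety F)
    (AK : ∀ (F : CMField) (ι₁ : F →+* ℂ) (V : HermSpace3 F ι₁) (Φ : CMType F), Subgroup (D F ι₁ V Φ).G → AbelianVariety F)
    (homE : ∀ (F : CMField) (ι₁ : F →+* ℂ) (V : HermSpace3 F ι₁) (Φ : CMType F) (K : Subgroup (D F ι₁ V Φ).G)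
      (Dμ : (D F ι₁ V Φ).Obj), (D F ι₁ V Φ).HomK K Dμ →+ ℚ ⊗[ℤ] (AK F ι₁ V Φ K ⟶ Aμ₀ F ι₁ V Φ Dμ))
    (hE : ∀ (F : CMField) (ι₁ : F →+* ℂ) (V : HermSpace3 F ι₁) (Φ : CMType F) (K : Subgroup (D F ι₁ V Φ).G)
      (Dμ : (D F ι₁ V Φ).Obj), Function.Injective (homE F ι₁ V Φ K Dμ))
    (hLiu : ∀ (F : CMField), IsGalois ℚ F → 6 ≤ Module.finrank ℚ F → ∀ (Φ : CMType F) (ι₁ : F →+* ℂ), ι₁ ∈ Φ.1 →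
      ∀ V : HermSpace3 F ι₁, Thm418AsPrinted (D F ι₁ V Φ))
    (hObj : ∀ (F : CMField), IsGalois ℚ F → 6 ≤ Module.finrank ℚ F → ∀ (Φ : CMType F) (ι₁ : F →+* ℂ), ι₁ ∈ Φ.1 →
      ∀ V : HermSpace3 F ι₁, Nonempty (D F ι₁ V Φ).Obj)
    (hChi : ∀ (F : CMField), IsGalois ℚ F → 6 ≤ Module.finrank ℚ F → ∀ (Φ : CMType F) (ι₁ : F →+* ℂ), ι₁ ∈ Φ.1 →
      ∀ V : HermSpace3 F ι₁, Nonempty (D F ι₁ V Φ).Chi)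
    (hirr : ∀ (F : CMField), IsGalois ℚ F → 6 ≤ Module.finrank ℚ F → ∀ (Φ : CMType F) (ι₁ : F →+* ℂ), ι₁ ∈ Φ.1 →
      ∀ (V : HermSpace3 F ι₁) (i : (D F ι₁ V Φ).AdmIndex), ((D F ι₁ V Φ).rhoAt i).IsIrreducible)
    (hsm : ∀ (F : CMField), IsGalois ℚ F → 6 ≤ Module.finrank ℚ F → ∀ (Φ : CMType F) (ι₁ : F →+* ℂ), ι₁ ∈ Φ.1 →
      ∀ (V : HermSpace3 F ι₁) (i : (D F ι₁ V Φ).AdmIndex) (v : (D F ι₁ V Φ).omegaAt i),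
        ∃ S : Subgroup (D F ι₁ V Φ).G, IsOpen (S : Set (D F ι₁ V Φ).G) ∧ ∀ k ∈ S, (D F ι₁ V Φ).rhoAt i k v = v)
    (hμ : ∀ (F : CMField), IsGalois ℚ F → 6 ≤ Module.finrank ℚ F → ∀ (Φ : CMType F) (ι₁ : F →+* ℂ), ι₁ ∈ Φ.1 →
      ∀ (V : HermSpace3 F ι₁) (g : F ≃ₐ[ℚ] F),
        ι₁.comp (g : F →+* F) ∈ (D F ι₁ V Φ).cmType.1 ↔ ι₁.comp (g.symm : F →+* F) ∈ Φ.1)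
    (i : ∀ (F : CMField) (ι₁ : F →+* ℂ) (V : HermSpace3 F ι₁) (Φ : CMType F) (Dμ : (D F ι₁ V Φ).Obj),
      muAlgValueField F (D F ι₁ V Φ).μ →+* (Aμ₀ F ι₁ V Φ Dμ).endAlgebra)
    (hdim : ∀ (F : CMField) [IsGalois ℚ F], 6 ≤ Module.finrank ℚ F → ∀ (Φ : CMType F) (ι₁ : F →+* ℂ), ι₁ ∈ Φ.1 →
      ∀ (V : HermSpace3 F ι₁) (Dμ : (D F ι₁ V Φ).Obj),
        Module.finrank ℚ (muAlgValueField F (D F ι₁ V Φ).μ) = 2 * (Aμ₀ F ι₁ V Φ Dμ).dim)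
    (hdet45 : ∀ (F : CMField) [IsGalois ℚ F], 6 ≤ Module.finrank ℚ F → ∀ (Φ : CMType F) (ι₁ : F →+* ℂ), ι₁ ∈ Φ.1 →
      ∀ (V : HermSpace3 F ι₁) (Dμ : (D F ι₁ V Φ).Obj) (x : muAlgValueField F (D F ι₁ V Φ).μ) (M : ℕ)
        (f : End (Aμ₀ F ι₁ V Φ Dμ)), M ≠ 0 →
        i F ι₁ V Φ Dμ x =
          algebraMap ℚ (Aμ₀ F ι₁ V Φ Dμ).endAlgebra (M : ℚ)⁻¹ * AbelianVariety.endAlgebra.of (Aμ₀ F ι₁ V Φ Dμ) f →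
        LinearMap.det (AbelianVariety.cotangentMap (Aμ₀ F ι₁ V Φ Dμ) f) =
          (M : F) ^ (Aμ₀ F ι₁ V Φ Dμ).dim * Def45.eta (AlgHom.id ℚ F) ι₁ (D F ι₁ V Φ).isConjugateSymplectic x)
    (hdetBC : ∀ (K : Type) [Field K] (L : Type) [Field L] [Algebra K L] (A : AbelianVariety K) (u : A ⟶ A),
      LinearMap.det (AbelianVariety.cotangentMap (A.baseChange L) (AbelianVariety.Hom.baseChange L u)) =
        algebraMap K L (LinearMap.det (AbelianVariety.cotangentMap A u)))
    (hW : cotangent_hodge10_comparison)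
    (hComp : ∀ (F : CMField), IsGalois ℚ F → 6 ≤ Module.finrank ℚ F → ∀ (Φ : CMType F) (ι₁ : F →+* ℂ), ι₁ ∈ Φ.1 →
      ∀ V : HermSpace3 F ι₁, ∃ Ksm : Subgroup (D F ι₁ V Φ).G, IsOpenCompact Ksm ∧
        ∀ K : Subgroup (D F ι₁ V Φ).G, IsOpenCompact K → K ≤ Ksm →
          ∃ (C : Type) (_ : Fintype C) (X : C → SchemeOver ℂ) (B : ∀ c, UnitaryBallUniformisationDatum 2 (X c))
            (Γ : C → Level V) (𝒥 : ∀ c, Jacobian (X c))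
            (π : ∀ c, (letI := ι₁.toAlgebra; (AK F ι₁ V Φ K).baseChange ℂ) ⟶ (𝒥 c).J),
            (∀ c, (B c).Hℂ = V.Hm.map ι₁) ∧
            (∀ c, (B c).Γ.map (Matrix.GeneralLinearGroup.map (B c).τ₁) =
              (Γ c).Γ.map (Matrix.GeneralLinearGroup.map ι₁)) ∧
            Nonempty (IsLimit (Fan.mk (letI := ι₁.toAlgebra; (AK F ι₁ V Φ K).baseChange ℂ) π)))
    (hD : ∀ (F : CMField), IsGalois ℚ F → 6 ≤ Module.finrank ℚ F → ∀ (f : Face F) (ι₁ : F →+* ℂ), f.Admissible ι₁ →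
      ∀ V : HermSpace3 F ι₁,
        ∃ (HG : Type) (_ : NormedAddCommGroup HG) (_ : InnerProductSpace ℂ HG)
          (emb : ∀ Γ : Level V, U.CohC (U.pms F ι₁ V Γ) 2 →ₗ[ℂ] HG)
          (cover : ∀ (Γ Γ' : Level V), Γ' ≤ Γ → U.Mor (U.pms F ι₁ V Γ') (U.pms F ι₁ V Γ)),
          (∀ (Γ : Level V) (ω₁ ω₂ : U.CohC (U.pms F ι₁ V Γ) 1), ω₁ ∈ U.Uiso Γ F (f.psi 0) ι₁ → ω₂ ∈ U.Uiso Γ F (f.psi 1) ι₁ →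
            emb Γ (U.cup2C (U.pms F ι₁ V Γ) 1 ω₁ ω₂) ∈ (Submodule.span ℂ
              {x : HG | ∃ (Γ' : Level V), ∃ ω₃ ∈ U.Uiso Γ' F (f.psi 2) ι₁, ∃ ω₄ ∈ U.Uiso Γ' F (f.psi 3) ι₁,
                x = emb Γ' (U.cup2C (U.pms F ι₁ V Γ') 1 ω₃ ω₄)}).topologicalClosure) ∧
          (∀ (Γ Γ' : Level V) (hle : Γ' ≤ Γ) (x : U.CohC (U.pms F ι₁ V Γ) 2),
            emb Γ' (U.pullC (cover Γ Γ' hle) 2 x) = emb Γ x) ∧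
          (∀ Γ : Level V, ∃ c : ℂ, c ≠ 0 ∧ ∀ x y : U.CohC (U.pms F ι₁ V Γ) 2,
            x ∈ (U.hodge (U.pms F ι₁ V Γ) 2).F 2 → y ∈ (U.hodge (U.pms F ι₁ V Γ) 2).F 2 →
              ⟪emb Γ y, emb Γ x⟫_ℂ = c * U.trC (U.pms F ι₁ V Γ) 4 (U.cup2C (U.pms F ι₁ V Γ) 2 x (conj y)))) :
    HC_CM := by
  subst hU
  exact hc_cm_of_supply_of_dictionary_of_eq _ rfl
    (exists_supplyWitness_of_faceSupply _ _ _ _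
      (faceSupply_of_thm418AsPrinted_pinnedE_def45 _ _ _ _ D Aμ₀ AK homE hE hLiu hObj hChi hirr hsm hμ i hdim hdet45 hdetBC hW hComp)) hD

end Display

end Summit.HodgeConjecture.CorCM.Model

end
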